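import Mathlib.LinearAlgebra.QuadraticForm.Signature
import Mathlib.LinearAlgebra.QuadraticForm.Real
import Mathlib.LinearAlgebra.FiniteDimensional.Lemmas
import Mathlib.Algebra.Ring.Parity
import HarnessLib

/-!
# The parity of the negative index of inertia of a binary form is the sign of its discriminant

Topic `Literature/LinearAlgebra/QuadraticForm` (a brick for the proof of the named fact
`Literature.Topology.Euclidean.poincareHopf_levelSurface`: the index `(-1)^λ` of the gradient of
a Morse function at a critical point of index `λ` on a surface is the sign of the Hessian
determinant — Milnor, *Topology from the Differentiable Viewpoint* (1965), §6, Lemma 4 p. 37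
with Milnor, *Morse theory* (1963), §2: the index is the negative index of inertia of the
Hessian).  Everything here is **proved**; no definition, no named fact.

**Sylvester's law of inertia on a plane, parity form** (`gramDet_ne_zero_and_pos_iff_even_sigNeg`):
for a nondegenerate symmetric bilinear form `H` on a real plane with Gram matrix `[[a, m], [m, c]]`
in a basis, the discriminant `a c - m²` is nonzero, and it is **positive iff Mathlib's negative
index of inertia `sigNeg (x ↦ H x x)` is even** — `sigNeg` is `0` or `2` for a definite form and
`1` for an indefinite one (W. Scharlau, *Quadratic and Hermitian Forms* (1985), Ch. 2 §4,
signature of real forms; here from Mathlib's `le_sigPos_of_posDef`, `le_sigNeg_of_negDef` and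
`QuadraticForm.sigPos_add_sigNeg_add_radical`, by completing the square
`a (a u² + 2 m u w + c w²) = (a u + m w)² + (a c - m²) w²`).

## References

* J. Milnor, *Topology from the Differentiable Viewpoint* (1965), §6 Lemma 4 (p. 37).
  [MilnorTDV1965]
-/

noncomputable section

open Module

namespace Literature.LinearAlgebra.QuadraticForm

variable {E : Type*} [AddCommGroup E] [Module ℝ E] [FiniteDimensional ℝ E]

omit [FiniteDimensional ℝ E] in
/-- Expansion of a bilinear form on a combination of two vectors. [folklore] -/
theorem bilin_apply_comb (H : LinearMap.BilinForm ℝ E) (ξ η : E) (x y x' y' : ℝ) :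
    H (x • ξ + y • η) (x' • ξ + y' • η) =
      x * x' * H ξ ξ + x * y' * H ξ η + y * x' * H η ξ + y * y' * H η η := by
  simp only [map_add, map_smul, LinearMap.add_apply, LinearMap.smul_apply, smul_eq_mul]
  ring

/-- **Sylvester's law of inertia on a plane, parity form.** For a nondegenerate symmetric bilinear
form `H` on a real plane with Gram matrix `[[a, m], [m, c]]` in a basis `b`, the Gram determinant
`a c - m²` is nonzero, and it is positive iff the negative index of inertia `sigNeg` of the
quadratic form `x ↦ H x x` is even (it is `0` or `2` for a definite form, `1` for an indefinite
one). [folklore] -/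
theorem gramDet_ne_zero_and_pos_iff_even_sigNeg (hE : finrank ℝ E = 2)
    (H : LinearMap.BilinForm ℝ E) (hsymm : ∀ x y, H x y = H y x) (hnd : H.Nondegenerate)
    (b : Basis (Fin 2) ℝ E) :
    H (b 0) (b 0) * H (b 1) (b 1) - H (b 0) (b 1) * H (b 0) (b 1) ≠ 0 ∧
      (0 < H (b 0) (b 0) * H (b 1) (b 1) - H (b 0) (b 1) * H (b 0) (b 1) ↔
        Even (sigNeg H.toQuadraticMap)) := by
  set ξ := b 0 with hξ
  set η := b 1 with hη
  set a := H ξ ξ with ha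
  set m := H ξ η with hm
  set c := H η η with hc
  have hm' : H η ξ = m := by rw [hsymm]
  set Q : QuadraticForm ℝ E := H.toQuadraticMap with hQ
  have hQapply : ∀ x, Q x = H x x := fun x => rfl
  -- every vector is a combination of `ξ` and `η`
  have hrepr : ∀ x : E, x = b.repr x 0 • ξ + b.repr x 1 • η := fun x => by
    conv_lhs => rw [← b.sum_repr x]
    rw [Fin.sum_univ_two]
  have hQcomb : ∀ x y : ℝ, Q (x • ξ + y • η) = a * x ^ 2 + 2 * m * x * y + c * y ^ 2 := by
    intro x y
    rw [hQapply, bilin_apply_comb, hm']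
    ring
  -- independence of `ξ`, `η`
  have hindep : ∀ x y : ℝ, x • ξ + y • η = 0 → x = 0 ∧ y = 0 := by
    intro x y hxy
    have h := b.linearIndependent
    rw [Fintype.linearIndependent_iff] at h
    have h' := h ![x, y] (by simpa [Fin.sum_univ_two] using hxy)
    exact ⟨h' 0, h' 1⟩
  -- (i) the Gram determinant is nonzero
  have hd : a * c - m * m ≠ 0 := by
    intro hd0
    -- a vector killed by `H`
    have hker : ∀ x y : ℝ, (∀ z, H (x • ξ + y • η) z = 0) → x = 0 ∧ y = 0 := by
      intro x y hz
      exact hindep x y (hnd.1 _ hz)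
    have hvan : ∀ x y : ℝ, H (x • ξ + y • η) ξ = 0 → H (x • ξ + y • η) η = 0 →
        ∀ z, H (x • ξ + y • η) z = 0 := by
      intro x y h1 h2 z
      rw [hrepr z, map_add, map_smul, map_smul, h1, h2, smul_zero, smul_zero, add_zero]
    by_cases hcm : c = 0 ∧ m = 0
    · -- then `η` is in the kernel
      have h1 : H ((0 : ℝ) • ξ + (1 : ℝ) • η) ξ = 0 := by simp [hm', hcm.2]
      have h2 : H ((0 : ℝ) • ξ + (1 : ℝ) • η) η = 0 := by simp [← hc, hcm.1]
      exact one_ne_zero (hker 0 1 (hvan 0 1 h1 h2)).2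
    · -- then `c • ξ - m • η` is in the kernel
      have h1 : H (c • ξ + (-m) • η) ξ = 0 := by
        rw [map_add, map_smul, map_smul, LinearMap.add_apply, LinearMap.smul_apply,
          LinearMap.smul_apply, hm', smul_eq_mul, smul_eq_mul, ← ha]
        linear_combination hd0
      have h2 : H (c • ξ + (-m) • η) η = 0 := by
        rw [map_add, map_smul, map_smul, LinearMap.add_apply, LinearMap.smul_apply,
          LinearMap.smul_apply, smul_eq_mul, smul_eq_mul, ← hm, ← hc]
        ring
      obtain ⟨hc0, hm0⟩ := hker c (-m) (hvan c (-m) h1 h2)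
      exact hcm ⟨hc0, neg_eq_zero.1 hm0⟩
  refine ⟨hd, ?_⟩
  -- signature bookkeeping
  have hfin : sigPos Q + sigNeg Q ≤ 2 := by
    have h := QuadraticForm.sigPos_add_sigNeg_add_radical (Q := Q)
    rw [hE] at h
    omega
  have hposvec : ∀ x : E, 0 < Q x → 1 ≤ sigPos Q := by
    intro x hx
    have hx0 : x ≠ 0 := by rintro rfl; simp [hQapply] at hx
    have hpd : (Q.restrict (ℝ ∙ x)).PosDef := by
      rintro ⟨z, hz⟩ hz0
      obtain ⟨t, rfl⟩ := Submodule.mem_span_singleton.1 hz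
      have ht : t ≠ 0 := by
        rintro rfl
        exact hz0 (by simp)
      rw [QuadraticMap.restrict_apply]
      change 0 < Q (t • x)
      rw [QuadraticMap.map_smul, smul_eq_mul]
      exact mul_pos (mul_self_pos.2 ht) hx
    have h := le_sigPos_of_posDef Q hpd
    rwa [finrank_span_singleton hx0] at h
  have hnegvec : ∀ x : E, Q x < 0 → 1 ≤ sigNeg Q := by
    intro x hx
    have hx0 : x ≠ 0 := by rintro rfl; simp [hQapply] at hx
    have hpd : ((-Q).restrict (ℝ ∙ x)).PosDef := by
      rintro ⟨z, hz⟩ hz0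
      obtain ⟨t, rfl⟩ := Submodule.mem_span_singleton.1 hz
      have ht : t ≠ 0 := by
        rintro rfl
        exact hz0 (by simp)
      rw [QuadraticMap.restrict_apply]
      change 0 < -Q (t • x)
      rw [QuadraticMap.map_smul, smul_eq_mul]
      have : 0 < t * t := mul_self_pos.2 ht
      nlinarith
    have h := le_sigNeg_of_negDef Q hpd
    rwa [finrank_span_singleton hx0] at h
  constructor
  · -- definite case: `sigNeg ∈ {0, 2}`
    intro hdpos
    have ha0 : a ≠ 0 := by
      rintro ha0
      rw [ha0, zero_mul, zero_sub] at hdpos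
      nlinarith [mul_self_nonneg m]
    rcases lt_or_gt_of_ne ha0 with haneg | hapos
    · -- negative definite: `sigNeg = 2`
      have hneg : ∀ x : E, x ≠ 0 → Q x < 0 := by
        intro x hx0
        rw [hrepr x, hQcomb]
        set u := b.repr x 0
        set w := b.repr x 1
        have huw : u ≠ 0 ∨ w ≠ 0 := by
          by_contra h
          push Not at h
          apply hx0
          rw [hrepr x]
          change u • ξ + w • η = 0
          rw [h.1, h.2, zero_smul, zero_smul, add_zero]
        -- `a Q = (a u + m w)² + d w²` with `a < 0`
        have key : a * (a * u ^ 2 + 2 * m * u * w + c * w ^ 2) =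
            (a * u + m * w) ^ 2 + (a * c - m * m) * w ^ 2 := by ring
        have hpos : 0 < (a * u + m * w) ^ 2 + (a * c - m * m) * w ^ 2 := by
          rcases huw with hu | hw
          · by_cases hw : w = 0
            · rw [hw]
              have h1 : 0 < a * u * (a * u) := mul_self_pos.2 (mul_ne_zero ha0 hu)
              nlinarith
            · have : 0 < w ^ 2 := by positivity
              nlinarith [sq_nonneg (a * u + m * w)]
          · have : 0 < w ^ 2 := by positivity
            nlinarith [sq_nonneg (a * u + m * w)]
        nlinarith
      have h2 : 2 ≤ sigNeg Q := by
        have hpd : ((-Q).restrict ⊤).PosDef := by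
          rintro ⟨z, hz⟩ hz0
          rw [QuadraticMap.restrict_apply]
          change 0 < -Q z
          have := hneg z fun h => hz0 (by simp [h])
          linarith
        have h := le_sigNeg_of_negDef Q hpd
        rwa [finrank_top, hE] at h
      have h2' : sigNeg Q = 2 := by omega
      rw [h2']
      exact ⟨1, rfl⟩
    · -- positive definite: `sigNeg = 0`
      have hposd : ∀ x : E, x ≠ 0 → 0 < Q x := by
        intro x hx0
        rw [hrepr x, hQcomb]
        set u := b.repr x 0
        set w := b.repr x 1
        have huw : u ≠ 0 ∨ w ≠ 0 := by
          by_contra h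
          push Not at h
          apply hx0
          rw [hrepr x]
          change u • ξ + w • η = 0
          rw [h.1, h.2, zero_smul, zero_smul, add_zero]
        have key : a * (a * u ^ 2 + 2 * m * u * w + c * w ^ 2) =
            (a * u + m * w) ^ 2 + (a * c - m * m) * w ^ 2 := by ring
        have hpos : 0 < (a * u + m * w) ^ 2 + (a * c - m * m) * w ^ 2 := by
          rcases huw with hu | hw
          · by_cases hw : w = 0
            · rw [hw]
              have h1 : 0 < a * u * (a * u) := mul_self_pos.2 (mul_ne_zero ha0 hu)
              nlinarith
            · have : 0 < w ^ 2 := by positivity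
              nlinarith [sq_nonneg (a * u + m * w)]
          · have : 0 < w ^ 2 := by positivity
            nlinarith [sq_nonneg (a * u + m * w)]
        nlinarith
      have h0 : sigNeg Q = 0 := by
        obtain ⟨V, hV, hVneg⟩ := exists_finrank_eq_sigNeg_and_negDef Q
        rw [← hV, Submodule.finrank_eq_zero]
        rw [Submodule.eq_bot_iff]
        intro x hx
        by_contra hx0
        have h1 := hVneg ⟨x, hx⟩ fun h => hx0 (by simpa using congrArg Subtype.val h)
        rw [QuadraticMap.restrict_apply] at h1
        change 0 < -Q x at h1
        have h2 := hposd x hx0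
        linarith
      rw [h0]
      exact ⟨0, rfl⟩
  · -- indefinite case: `sigNeg = 1`
    intro heven
    by_contra hdpos
    have hdneg : a * c - m * m < 0 := lt_of_le_of_ne (not_lt.1 hdpos) hd
    -- a positive and a negative vector
    obtain ⟨xp, hxp, xn, hxn⟩ : ∃ xp : E, 0 < Q xp ∧ ∃ xn : E, Q xn < 0 := by
      by_cases ha0 : a = 0
      · by_cases hc0 : c = 0
        · have hm0 : m ≠ 0 := by
            rintro hm0; rw [ha0, hc0, hm0] at hdneg; norm_num at hdneg
          have h1 : Q ((1 : ℝ) • ξ + (1 : ℝ) • η) = 2 * m := by rw [hQcomb, ha0, hc0]; ring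
          have h2 : Q ((1 : ℝ) • ξ + (-1 : ℝ) • η) = -(2 * m) := by rw [hQcomb, ha0, hc0]; ring
          rcases lt_or_gt_of_ne hm0 with hmneg | hmpos
          · exact ⟨_, by rw [h2]; linarith, _, by rw [h1]; linarith⟩
          · exact ⟨_, by rw [h1]; linarith, _, by rw [h2]; linarith⟩
        · -- `Q η = c`, `Q(-c ξ + m η) = -c m²`
          have hm0 : m ≠ 0 := by
            rintro hm0; rw [ha0, hm0] at hdneg; norm_num at hdneg
          have h1 : Q ((0 : ℝ) • ξ + (1 : ℝ) • η) = c := by rw [hQcomb]; ring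
          have h2 : Q ((-c) • ξ + m • η) = -c * m ^ 2 := by rw [hQcomb, ha0]; ring
          have hm2 : 0 < m ^ 2 := by positivity
          rcases lt_or_gt_of_ne hc0 with hcneg | hcpos
          · exact ⟨_, by rw [h2]; nlinarith, _, by rw [h1]; exact hcneg⟩
          · exact ⟨_, by rw [h1]; exact hcpos, _, by rw [h2]; nlinarith⟩
      · -- `Q ξ = a`, `Q(m ξ - a η) = a (a c - m²)`
        have h1 : Q ((1 : ℝ) • ξ + (0 : ℝ) • η) = a := by rw [hQcomb]; ring
        have h2 : Q (m • ξ + (-a) • η) = a * (a * c - m * m) := by rw [hQcomb]; ring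
        rcases lt_or_gt_of_ne ha0 with haneg | hapos
        · exact ⟨_, by rw [h2]; nlinarith, _, by rw [h1]; exact haneg⟩
        · exact ⟨_, by rw [h1]; exact hapos, _, by rw [h2]; nlinarith⟩
    have h1 := hposvec xp hxp
    have h2 := hnegvec xn hxn
    have h3 : sigNeg Q = 1 := by omega
    rw [h3] at heven
    exact Nat.not_even_one heven

end Literature.LinearAlgebra.QuadraticForm
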